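import Summits.AtomisticToContinuum.BoseEinsteinCondensation.Theses.BECProbeMassFlow

/-!
# Route `BECProbeMassFlow`, assembly item `Assembly` (stmt-AtomisticToContinuum-12313)

Settles the assembly item `stmt-AtomisticToContinuum-12313` of route
`route-AtomisticToContinuum-BECProbeMassFlow`: the implication

  `CloudMomentumAtom → RecoilTransfer → StaticFloorCondenses → BoundaryTransferWeak →
    BoseEinsteinCondensation`

(the audited sub-problem abbrev `_root_.BoseEinsteinCondensation`, by name).

The hypotheses of `Assembly` are, verbatim and in the same order, those of the route's deciding
theorem `closes`, so the assembly is that composition, spelled out per potential: fix a repulsive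
finite-range `v`; `CloudMomentumAtom` and `RecoilTransfer` give their bodies for `v`; the glue
`StaticFloorCondenses` turns the two bodies into the periodic-BEC body for `v` (constant-mode
condensation `≥ c N` of `δ`-near-minimisers on the torus, all small `ρ`, eventually in `N`), which
is exactly the hypothesis of `BoundaryTransferWeak` for `v`; the latter yields
`∃ ρ₀ > 0, ∀ ρ ∈ (0, ρ₀), HasGroundStateBEC v ρ`, i.e. the conjunct at `v`.
Pure logic; no analytic content lives here.

References: [LSSY2005, §1.2 and Ch. 5] (the conjunct being assembled), [PenroseOnsager1956]
(the one-mode occupation criterion behind the periodic-BEC body).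
-/

namespace Summit.AtomisticToContinuum.BoseEinsteinCondensation.Theorems

/-- **Item stmt-AtomisticToContinuum-12313** (`Assembly` of route `BECProbeMassFlow`, exact route
decl): given `h₁ : CloudMomentumAtom`, `h₂ : RecoilTransfer`, the glue `h₃ : StaticFloorCondenses`
and the boundary-condition transfer `h₄ : BoundaryTransferWeak`, for every repulsive finite-range
`v` the term `h₄ v hv (h₃ v hv (h₁ v hv) (h₂ v hv))` is `∃ ρ₀ > 0, ∀ ρ ∈ (0, ρ₀), HasGroundStateBEC v ρ`,
which is `BoseEinsteinCondensation` at `v`. Pure composition of the route's hypotheses (the route's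
deciding theorem `closes`, curried). [folklore] -/
theorem becProbeMassFlow_assembly_proof :
    Summit.AtomisticToContinuum.BoseEinsteinCondensation.Theses.BECProbeMassFlow.Assembly := by
  unfold Theses.BECProbeMassFlow.Assembly
  intro h₁ h₂ h₃ h₄
  exact fun v hv => h₄ v hv (h₃ v hv (h₁ v hv) (h₂ v hv))

end Summit.AtomisticToContinuum.BoseEinsteinCondensation.Theorems
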